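import Summits.QuantumFields.BalabanUV.T4Continuum.Spine.NE3.PairAxialGaugeB8
import Literature.MathematicalPhysics.QuantumFieldTheory.Balaban1983to89.B8Eq137ConstraintPair
import HarnessLib

/-!
# T⁴ programme, node NE3 (pub-ymgap DAG node N16) — `PairLandauGaugeB8Avg`'s member `dbar` ((1.37) at the pair: `dbavgCovIter L W (relPert W Z) k = 1`)
# IS FREE GIVEN [B8] THEOREM 4's RESTRICTION (1.29): for the minimiser pair `(W, U_A)`, `W = rescale L (bavg L U_B)`, ANY representative
# `U_A^{u_L} = W·e^{Z}` whose transition gauge to the pinned axial pre-gauge satisfies (1.29) at the top level has `U̿₁ᵏ = 1` EXACTLY (`PairDbarB8`)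

Cell `pub-ymgap`, HUMAN RULING D-0062, seat `pub-ymgap-dag-n16-b` (FIRST-MISSING-ESTIMATE for N16 = NE3; writer prover-pub-ymgap-dag-n16-b-g0-0,
2026-08-25).  NE3-pair reading of the Literature identity `Balaban1983to89.B8Eq137ConstraintPair.dbavgCovIter_eq_one_of_restr129`
([B7] (84)∕(87)∕(88) + [B8] (1.29)): the pub-balaban-gaps census ne∕NE3.md R49–R51 located the (1.37) clause `LandauRepB8Avg.dbar` as a FRAME
CONDITION on the gauge, left open as «(M1) smooth frame normalisation jointly with the Landau step» ∕ R53.  In the DAG reading (N16 consumes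
[B8] Theorem 4 BY NAME) it is NOT an extra obligation: Theorem 4's own restriction (1.29) on the gauge transformation — typed
`B8Eq119TwistedAxial.Restr129`, the candidate instance of `Thm4At`'s abstract `Restr` — forces it, by pure averaging algebra, because the
INPUT of Theorem 4 at the pair (the pinned axial pre-gauge of `PairAxialGaugeB8`) keeps the constraint `Ū_Aᵏ = V = W̄ᵏ`.

WHAT ([folklore]; 0 def, 0 sorry): **`dbar_of_restr129_pair`** — for `U_A` a run-`k` minimiser and `U_B` a `(b, g)`-regular run-`(k+1)` minimiser
over `sfClass d L N ε` with the same datum (the quantifier prefix of `PairLandauGaugeB8Avg`), radii in the regime of `PairAxialGaugeB8`, ANY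
direction `Z` (the `Z` of `LandauRepB8.rep`: `U_A^{u_L} = vary W Z 1`) and ANY gauge transformation `u` with `(vary W Z 1)^{u} = U_A^{u₀}`
(`u₀ = ptw L W U_A k` the pinned axial pre-gauge — so `u` is [B8]'s `u` of «`U₁ = U′^{u⁻¹}`», the Landau → axial transition) satisfying (1.29)
`Restr129 L k Λ W u` with `Λ k = univ`:  **`dbavgCovIter L W (relPert W Z) k = 1`** — `LandauRepB8Avg.dbar` verbatim.
PRINTED LOCI: [B8] (1.29) p. 81, (1.31)∕(1.37) p. 82, Thm 4 p. 88; [B7] (81) p. 30, (84) p. 30, (87)–(88) p. 31, (92) p. 31.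
HONEST FRAMING (page 1): bookkeeping over landed theorems; NO existence statement (the gauge `u` with (1.29) and the Landau representative are
Theorem 4's OUTPUT, NOT proved anywhere in the tree at a curved background); Thm 2 ∕ NE3 NOT proved; spine 0∕9; finite T⁴ rung (B)+1 at fixed ε —
NOT infinite volume, NOT mass gap, NOT `BetaPertH`, NOT Clay.  PLACEMENT: `Spine/NE3/`.
-/

set_option autoImplicit false

open scoped BigOperators Matrix Matrix.Norms.L2Operator
open NormedSpace

namespace Summit.QuantumFields.BalabanUV.T4Continuum.NE3.PairDbarB8

open Literature.MathematicalPhysics.QuantumFieldTheory.Balaban1983to89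
open B7Prop1Explicit B7Prop2Explicit
open B7Eq92Concrete (dbavgCovIter)
open B8Eq115GaugeFixing (gaugeAct_mul)
open B8Eq119TwistedAxial (Restr129)
open B8Eq166ConstraintPair (ptw pinnedTwistedFix_global)
open B8Eq137ConstraintPair (dbavgCovIter_eq_one_of_restr129)
open B12Ineq417Flat (shiftCfg)
open T4AveragingDeficitWall (IsUnitaryCfg SmallField vary)
open T4AveragingDeficitWallBoundary (IsPeriodicCfg)
open MinimalActionSandwich (IsMinimiser)
open MinimalActionRate (Regular sfClass rescale_bavg_mem_sfClass)
open NE3.PairLandauB8Avg (relPert relPert_mul_eq_vary)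
open NE3.PairFrameCondition (avgIter_eq_of_isMinimiser avgIter_rescale_bavg_eq_of_isMinimiser)
open NE3.SupplierB8SfClassPrep (pdev_le_of_smallField)

noncomputable section

variable {d : ℕ} {n : Type*} [Fintype n] [DecidableEq n]

omit [Fintype n] [DecidableEq n] in
/-- `a / t² < α · (t⁻¹)²` for `a < α`, `1 ≤ t`. [folklore] -/
private theorem div_sq_lt {a α t : ℝ} (h : a < α) (ht : 1 ≤ t) : a / t ^ 2 < α * (t⁻¹) ^ 2 := by
  have ht0 : 0 < t := by linarith
  rw [inv_pow, ← div_eq_mul_inv]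
  exact div_lt_div_of_pos_right h (by positivity)

/-- `relPert W Z · W = vary W Z 1` as configurations (`PairLandauB8Avg.relPert_mul_eq_vary`). [folklore] -/
private theorem relPert_mul (W : Site d → Fin d → (Matrix n n ℂ)ˣ) (Z : Site d → Fin d → Matrix n n ℂ) :
    relPert W Z * W = vary W Z 1 := by
  rw [← relPert_mul_eq_vary]; rfl

/-- **`dbar` AT THE PAIR IS FREE GIVEN (1.29)** (statement in the module docstring). [folklore] -/
theorem dbar_of_restr129_pair [Nonempty n] (hd : 1 ≤ d) {L N : ℕ} (hL : 2 ≤ L) {ε b g α : ℝ} {k : ℕ}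
    {V UA UB : Site d → Fin d → (Matrix n n ℂ)ˣ}
    (hA : IsMinimiser d (sfClass d L N ε) L N k V UA) (hB : IsMinimiser d (sfClass d L N ε) L N (k + 1) V UB)
    (hreg : Regular d L N b g (k + 1) UB) (hε : 0 ≤ ε) (hb : 0 ≤ b)
    (hbs : 512 * (d + 1) * (d + 4) * (L : ℝ) ^ 2 * b ≤ 1) (hα : 0 < α) (hεα : ε < α)
    (hbα : b + 226 * (8 * (d + 1) * (d + 4)) ^ 2 * b ^ 2 < α)
    (hα3 : C0 d * α ≤ 1 / 3) (hα2 : 2 * α ≤ c2' d L)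
    {u : Site d → (Matrix n n ℂ)ˣ} {Z : Site d → Fin d → Matrix n n ℂ}
    (hu : gaugeAct u (vary (rescale L (bavg L UB)) Z 1) = gaugeAct (ptw L (rescale L (bavg L UB)) UA k) UA)
    {Λ : ℕ → Set (Site d)} (hΛ : Λ k = Set.univ) (hres : Restr129 L k Λ (rescale L (bavg L UB)) u) :
    dbavgCovIter L (rescale L (bavg L UB)) (relPert (rescale L (bavg L UB)) Z) k = 1 := by
  letI : CStarAlgebra (Matrix n n ℂ) := {}
  have hL1 : 1 ≤ L := le_trans (by norm_num) hL
  have hL1r : (1 : ℝ) ≤ L := by exact_mod_cast hL1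
  have hLk : (1 : ℝ) ≤ (L : ℝ) ^ k := one_le_pow₀ hL1r
  have hG := avgClosed_unitaryUnits d (𝔸 := Matrix n n ℂ) L
  set W : Site d → Fin d → (Matrix n n ℂ)ˣ := rescale L (bavg L UB) with hWdef
  obtain ⟨hAu, -, hAsm⟩ := hA.mem.1
  obtain ⟨hWu, -, hWsm⟩ := rescale_bavg_mem_sfClass hL1 hb hbs le_rfl hreg
  have hb' : 0 ≤ b + 226 * (8 * (d + 1) * (d + 4)) ^ 2 * b ^ 2 := by positivity
  have h34 : pdev UA < α * (((L : ℝ) ^ k)⁻¹) ^ 2 :=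
    (pdev_le_of_smallField (div_nonneg hε (by positivity)) hAsm).trans_lt (div_sq_lt hεα hLk)
  have h33 : pdev W < α * (((L : ℝ) ^ k)⁻¹) ^ 2 :=
    (pdev_le_of_smallField (div_nonneg hb' (by positivity)) hWsm).trans_lt (div_sq_lt hbα hLk)
  -- the pinned axial pre-gauge: (1.19) at every block of every level and the constraint kept
  obtain ⟨-, -, -, -, h19, hkeep⟩ := pinnedTwistedFix_global L hL hG k W UA hWu hAu hα hα3 hα2 h33 h34
  have hin : gaugeAct u (relPert W Z * W) = gaugeAct (ptw L W UA k) UA := by rw [relPert_mul]; exact hu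
  have hpair : avgIter L UA k = avgIter L W k := by
    rw [avgIter_eq_of_isMinimiser hA, hWdef, avgIter_rescale_bavg_eq_of_isMinimiser hB]
  refine dbavgCovIter_eq_one_of_restr129 L W (relPert W Z) u k hΛ hres (fun j hj z r => ?_) ?_
  · have h := h19 (k - 1 - j) (by omega) z r
    rw [show k - (k - 1 - j + 1) = j by omega] at h
    rw [hin]; exact h
  · rw [hin, hkeep, hpair]

end

end Summit.QuantumFields.BalabanUV.T4Continuum.NE3.PairDbarB8
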